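import Literature.NumberTheory.LFunctions.AdditiveTwistContinuationProofs
import Literature.NumberTheory.Automorphic.ArtinLFunctionsRankOneMatching
import Literature.NumberTheory.Automorphic.BookerStrongArtin
import HarnessLib

/-!
# Booker 2003, Lemma 1: the named fact `Booker2003_lemma1` holds

Topic `Literature/NumberTheory/LFunctions`; namespace `Literature.NumberTheory.LFunctions`.  Discharge
(D-0014/D-0026) of the named fact `Booker2003_lemma1` of `AdditiveTwist.lean`:

> **Booker, *Poles of Artin L-functions and the strong Artin conjecture*, Ann. of Math. 158 (2003),
> Lemma 1 (p. 1092).** "Let `α` be a rational number.  Then `L(s,ρ,α)` has meromorphic continuation to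
> the complex plane, with poles possible only in the strip `0 < Re(s) < 1`, and is expressible as the
> ratio of two entire functions of order 1."

(the tree's fact records the continuation and the location of the poles, for irreducible even
`ρ : Γ_ℚ → GL₂(ℂ)`; it is word for word the statement of the named fact
`Literature.NumberTheory.Automorphic.booker_additiveTwist_meromorphic` of
`Automorphic/BookerStrongArtin.lean`, discharged in `Automorphic/BookerStrongArtinAdditiveTwistHolds.lean`).
Booker's proof is assembled in `AdditiveTwistContinuationProofs`
(`Booker2003_lemma1_of_artin_functional_equation`): the algebraic half — "`L(s, ρ, α) ∈ V`", the
additive twist is a finite combination of character twists `qᵢ^{-s} L(s, ρ ⊗ χᵢ)` with the Euler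
factors at `p` handled as polynomials in `p^{-s}`, Booker (6)–(8) (`AdditiveTwistArtin`,
`AdditiveTwistProofs`) — and the analytic half — each `L(s, ρ ⊗ χ₀)` "is holomorphic in `Re(s) ≥ 1`"
(Heilbronn) "and by the functional equation, in `Re(s) ≤ 0`" (p. 1091).  The one input that was a
named fact, Artin's functional equation over `ℚ` (Neukirch VII (12.6)), is now the tree theorem
`Automorphic.artin_functional_equation_holds` (`Automorphic/ArtinLFunctionsRankOneMatching`), so the
fact holds outright.

## References

* A. R. Booker, *Poles of Artin L-functions and the strong Artin conjecture*, Ann. of Math. (2) 158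
  (2003), 1089–1098, Lemma 1 and its proof, pp. 1091–1093. [Booker2003]
* J. Neukirch, *Algebraic Number Theory*, Springer 1999, Ch. VII §12 Thm. (12.6). [NeukirchANT1999]
-/

noncomputable section

namespace Literature.NumberTheory.LFunctions

/-- **Booker 2003, Lemma 1 — the named fact `Booker2003_lemma1` holds**: for every irreducible even
`σ : Γ_ℚ → GL₂(ℂ)` with Dirichlet coefficients `a` (`LSeries a = L(s, σ)` on `Re s > 1`) and every
rational `x`, the additive twist `∑ aₙ e(nx) n^{-s}` agrees on `Re s > 1` with a function meromorphic
on `ℂ` and analytic at every `s` with `Re s ≤ 0` or `Re s ≥ 1`.  Proof: Booker's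
(`Booker2003_lemma1_of_artin_functional_equation`), with Artin's functional equation over `ℚ`
supplied by the theorem `Automorphic.artin_functional_equation_holds`.
[cite: Booker2003, Lemma 1 (p. 1092) and its proof (pp. 1091–1093)] -/
theorem Booker2003_lemma1_holds : Booker2003_lemma1 :=
  Booker2003_lemma1_of_artin_functional_equation Automorphic.artin_functional_equation_holds

/-- The two renderings of Booker's Lemma 1 in the tree are the same statement: the named fact
`Booker2003_lemma1` of `AdditiveTwist.lean` is, word for word, the named fact
`Automorphic.booker_additiveTwist_meromorphic` of `Automorphic/BookerStrongArtin.lean`.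
[cite: Booker2003, Lemma 1 (p. 1092)] -/
theorem Booker2003_lemma1_iff_booker_additiveTwist_meromorphic :
    Booker2003_lemma1 ↔ Automorphic.booker_additiveTwist_meromorphic :=
  Iff.rfl

end Literature.NumberTheory.LFunctions

end
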